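import Mathlib
import HarnessLib
import Summits.HubbardSuperconductivity.HubbardSuperconductivity.Theorems.KLProgrammeThermalGreenHubbardTorusExact
import Literature.MathematicalPhysics.QuantumLattice.HubbardThermalFermionDecayProofs

/-!
# Fermionic Matsubara coefficients through the REAL-TIME RESOLVENT: `∫₀^β e^{ikτ}⟨A(τ)B⟩_β dτ = −⟨{X, B}⟩_β` for
# `ikX + [H,X] = A`, and the transfer of anticommutator light-cone bounds to every Matsubara coefficient
# (seat hubbard-kl-k3c5-p3 g6, technique «OS-positivity-free direct assembly»; VL child of K3, `--supports` stmt-…-19921)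

Route `KLProgramme`, crux K3, child VOLUME-LIMIT (gen 5 `KLRegimeVolumeLimitV14`, gen 6 `KLRegimeVolumeLimitV15`).  The one open stub
`stub_vl_carrierRate` asks for a two-volume rate WITH a one-volume torus-Lipschitz momentum modulus (M) of the bare last-scale self-energy; the
doors of this lineage (`carrierRateText_of_nested`, …) take (M) as a separate hypothesis `hM`.  This file is the model-free core of the proof that
(M) holds for EVERY coupling (Hastings' mechanism, PRL 93 (2004) 126402, in MATSUBARA form): a fermionic Matsubara coefficient of a thermal
two-time function is a STATE value of an anticommutator with the real-time resolvent of the first operator, so any OPERATOR-NORM light-cone bound on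
`{τ_{±t}(A), B}` (Lieb–Robinson) bounds it, uniformly in whatever the light cone is uniform in (the volume).  For a Hermitian `H`, the Gibbs state
`⟨·⟩_β = Matrix.gibbsState β H`, `A(τ) = Matrix.imagTimeEvolve H τ A = e^{τH}Ae^{−τH}`, `τ_t(A) = heisenbergEvolution H t A = e^{itH}Ae^{−itH}` and a
FERMIONIC frequency `k` (`e^{ikβ} = −1`):

* §1 `fermionic_matsubara_resolvent` — for EVERY matrix `X`: `∫₀^β e^{ikτ}⟨(ikX + [H,X])(τ)·B⟩_β dτ = −⟨XB + BX⟩_β`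
  (one Matsubara integration by parts, `fermionic_matsubara_ibp`, whose boundary term is KMS);
* §2 `resolvent_identity_of_hasDerivAt` — finite-horizon resolvents: if `Φ′ = −(ikc·Φ + c·[H,Φ])` on `ℝ` then `X_T := c·∫₀^T Φ` satisfies
  `ikX_T + [H,X_T] = Φ(0) − Φ(T)`; the two instances `Φ(t) = e^{−|k|t}τ_{±t}(A)` (`c = ∓i`, sign of `k`), for which `Φ(0) = A` and
  `‖Φ(T)‖ = e^{−|k|T}‖A‖`;
* §3 **`norm_fermionic_matsubara_le_of_anticommutator_bound`** — if `‖{τ_t(A), B}‖ ≤ F(t)` and `‖{τ_{−t}(A), B}‖ ≤ F(t)` for `t ≥ 0` with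
  `t ↦ e^{−|k|t}F(t)` integrable on `(0, ∞)`, then **`‖∫₀^β e^{ikτ}⟨A(τ)B⟩_β dτ‖ ≤ ∫₀^∞ e^{−|k|t} F(t) dt`** — no eigenbasis, no positivity, the
  state enters only through `|⟨Y⟩_β| ≤ ‖Y‖` and the two-time Gibbs bound on the horizon remainder.

Consumers (this seat, next files): with the tree's torus anticommutator light cone `norm_anticommutator_hubbardTorus_le` (HubbardThermalFermionDecayProofs)
this gives `L`-uniform, label-uniform decay of `∫₀^β e^{ik₀τ}⟨A_z(τ)A_w†⟩` in `dist(z,w)` for single-site odd modes, hence the momentum modulus of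
k3c5-p1's `Six∞_L(n,p) = −∫₀^β e^{ik₀τ}⟨T′(τ)T′†⟩` and of `Σ∞⁰ = U·occ∞ + U²·Six∞`.  Everything is proved; no definition.
-/

noncomputable section

namespace Summit.HubbardSuperconductivity.HubbardSuperconductivity.Theorems.ThermalGreen

set_option linter.dupNamespace false -- summit = problem name (single-conjunct summit), D-0017

open scoped Matrix.Norms.L2Operator
open Matrix Complex MeasureTheory intervalIntegral Literature.MathematicalPhysics.QuantumLattice

variable {n : Type*} [Fintype n] [DecidableEq n]

/-! ## §1 The resolvent form of one Matsubara integration by parts -/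

/-- **`∫₀^β e^{ikτ}⟨(ikX + [H,X])(τ)·B⟩_β dτ = −⟨XB + BX⟩_β`** for every matrix `X` and every fermionic frequency `k` (`e^{ikβ} = −1`):
`fermionic_matsubara_ibp` for `X`, multiplied through by `ik`. -/
theorem fermionic_matsubara_resolvent (β : ℝ) (H X B : Matrix n n ℂ) {k : ℝ} (hk : cexp (I * k * β) = -1) :
    ∫ τ in (0 : ℝ)..β, cexp (I * k * τ) * gibbsState β H (imagTimeEvolve H (τ : ℂ) ((I * k) • X + (H * X - X * H)) * B) =
      -(gibbsState β H (X * B + B * X)) := by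
  have hk' : (k : ℂ) ≠ 0 := by exact_mod_cast ne_zero_of_cexp_eq_neg_one hk
  have hlin := matsubara_lin_left β H X (H * X - X * H) B (I * k) 1 k
  rw [one_smul, one_mul] at hlin
  rw [hlin, fermionic_matsubara_ibp β H X B hk]
  field_simp
  ring_nf

/-! ## §2 Finite-horizon real-time resolvents -/

/-- Left multiplication commutes with the interval integral. -/
theorem mul_intervalIntegral_eq (H : Matrix n n ℂ) {Φ : ℝ → Matrix n n ℂ} (hΦ : Continuous Φ) (a b : ℝ) :
    H * (∫ t in a..b, Φ t) = ∫ t in a..b, H * Φ t := by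
  have hi : IntervalIntegrable Φ MeasureTheory.volume a b := hΦ.intervalIntegrable a b
  have h := ((ContinuousLinearMap.mul ℂ (Matrix n n ℂ)) H).intervalIntegral_comp_comm hi
  simpa using h.symm

/-- Right multiplication commutes with the interval integral. -/
theorem intervalIntegral_mul_eq (H : Matrix n n ℂ) {Φ : ℝ → Matrix n n ℂ} (hΦ : Continuous Φ) (a b : ℝ) :
    (∫ t in a..b, Φ t) * H = ∫ t in a..b, Φ t * H := by
  have hi : IntervalIntegrable Φ MeasureTheory.volume a b := hΦ.intervalIntegrable a b
  have h := ((ContinuousLinearMap.mul ℂ (Matrix n n ℂ)).flip H).intervalIntegral_comp_comm hi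
  simpa using h.symm

/-- **Finite-horizon resolvent identity.**  If `Φ` is differentiable on `ℝ` with continuous derivative `Φ′` and
`ikc·Φ(t) + c·[H,Φ(t)] = −Φ′(t)` for all `t`, then `X_T := c·∫₀^T Φ` satisfies `ik·X_T + [H, X_T] = Φ(0) − Φ(T)` (fundamental theorem of calculus). -/
theorem resolvent_identity_of_hasDerivAt (H : Matrix n n ℂ) (k : ℝ) (c : ℂ) (T : ℝ) {Φ Φ' : ℝ → Matrix n n ℂ}
    (hderiv : ∀ t, HasDerivAt Φ (Φ' t) t) (hcont : Continuous Φ')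
    (hode : ∀ t, (I * k * c) • Φ t + c • (H * Φ t - Φ t * H) = -Φ' t) :
    (I * k : ℂ) • (c • ∫ t in (0 : ℝ)..T, Φ t) +
        (H * (c • ∫ t in (0 : ℝ)..T, Φ t) - (c • ∫ t in (0 : ℝ)..T, Φ t) * H) = Φ 0 - Φ T := by
  have hΦc : Continuous Φ := continuous_iff_continuousAt.mpr fun t => (hderiv t).continuousAt
  have hFTC : ∫ t in (0 : ℝ)..T, Φ' t = Φ T - Φ 0 :=
    integral_eq_sub_of_hasDerivAt (fun t _ => hderiv t) (hcont.intervalIntegrable 0 T)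
  have h1 : (I * k : ℂ) • (c • ∫ t in (0 : ℝ)..T, Φ t) = ∫ t in (0 : ℝ)..T, (I * k * c) • Φ t := by
    rw [smul_smul, intervalIntegral.integral_smul]
  have hiL : IntervalIntegrable (fun t => H * Φ t) MeasureTheory.volume 0 T := (continuous_const.mul hΦc).intervalIntegrable _ _
  have hiR : IntervalIntegrable (fun t => Φ t * H) MeasureTheory.volume 0 T := (hΦc.mul continuous_const).intervalIntegrable _ _
  have hsub : ∫ t in (0 : ℝ)..T, (H * Φ t - Φ t * H) = (∫ t in (0 : ℝ)..T, H * Φ t) - ∫ t in (0 : ℝ)..T, Φ t * H :=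
    intervalIntegral.integral_sub hiL hiR
  have h2 : H * (c • ∫ t in (0 : ℝ)..T, Φ t) - (c • ∫ t in (0 : ℝ)..T, Φ t) * H =
      ∫ t in (0 : ℝ)..T, c • (H * Φ t - Φ t * H) := by
    rw [Matrix.mul_smul, Matrix.smul_mul, mul_intervalIntegral_eq H hΦc, intervalIntegral_mul_eq H hΦc, ← smul_sub,
      ← hsub, intervalIntegral.integral_smul]
  have hi1 : IntervalIntegrable (fun t => (I * k * c) • Φ t) MeasureTheory.volume 0 T :=
    ((continuous_const (y := (I * k * c : ℂ))).smul hΦc).intervalIntegrable _ _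
  have hcomm : Continuous fun t => H * Φ t - Φ t * H := (continuous_const.mul hΦc).sub (hΦc.mul continuous_const)
  have hi2 : IntervalIntegrable (fun t => c • (H * Φ t - Φ t * H)) MeasureTheory.volume 0 T :=
    ((continuous_const (y := c)).smul hcomm).intervalIntegrable _ _
  have hadd : ∫ t in (0 : ℝ)..T, ((I * k * c) • Φ t + c • (H * Φ t - Φ t * H)) =
      (∫ t in (0 : ℝ)..T, (I * k * c) • Φ t) + ∫ t in (0 : ℝ)..T, c • (H * Φ t - Φ t * H) :=
    intervalIntegral.integral_add hi1 hi2
  have h3 : ∫ t in (0 : ℝ)..T, ((I * k * c) • Φ t + c • (H * Φ t - Φ t * H)) = ∫ t in (0 : ℝ)..T, -Φ' t :=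
    intervalIntegral.integral_congr fun t _ => hode t
  rw [h1, h2, ← hadd, h3, intervalIntegral.integral_neg, hFTC]
  abel

/-- `τ_t(i[H,A]) = i[H, τ_t(A)]` (the Hamiltonian is fixed by its own flow). -/
theorem heisenbergEvolution_comm_smul (H A : Matrix n n ℂ) (t : ℝ) :
    heisenbergEvolution H t (I • (H * A - A * H)) = I • (H * heisenbergEvolution H t A - heisenbergEvolution H t A * H) := by
  have h1 : heisenbergEvolution H t (H * A) = H * heisenbergEvolution H t A := by
    rw [heisenbergEvolution_mul, heisenbergEvolution_self]
  have h2 : heisenbergEvolution H t (A * H) = heisenbergEvolution H t A * H := by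
    rw [heisenbergEvolution_mul, heisenbergEvolution_self]
  have h3 : heisenbergEvolution H t (H * A - A * H) = heisenbergEvolution H t (H * A) - heisenbergEvolution H t (A * H) := by
    simp only [heisenbergEvolution, Matrix.mul_sub, Matrix.sub_mul]
  have h4 : heisenbergEvolution H t (I • (H * A - A * H)) = I • heisenbergEvolution H t (H * A - A * H) := by
    simp only [heisenbergEvolution, Matrix.mul_smul, Matrix.smul_mul]
  rw [h4, h3, h1, h2]

/-- The derivative of the Heisenberg evolution in commutator form: `d/dt τ_t(A) = i[H, τ_t(A)]`. -/
theorem hasDerivAt_heisenbergEvolution_comm (H A : Matrix n n ℂ) (t : ℝ) :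
    HasDerivAt (fun u : ℝ => heisenbergEvolution H u A)
      (I • (H * heisenbergEvolution H t A - heisenbergEvolution H t A * H)) t := by
  have h : HasDerivAt (fun u : ℝ => heisenbergEvolution H u A) (heisenbergEvolution H t (I • (H * A - A * H))) t := by
    refine (hasDerivAt_heisenbergEvolution H A t).congr_deriv ?_
    rw [heisenbergEvolution_eq_exp_smul, smul_sub, smul_mul_assoc, mul_smul_comm]
  rw [heisenbergEvolution_comm_smul] at h
  exact h

/-- The scaled flow `u ↦ τ_{εu}(A)`: `d/du τ_{εu}(A) = ε·i[H, τ_{εu}(A)]` (`ε = ±1` gives the two time directions). -/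
theorem hasDerivAt_heisenbergEvolution_scaled (H A : Matrix n n ℂ) (ε t : ℝ) :
    HasDerivAt (fun u : ℝ => heisenbergEvolution H (ε * u) A)
      ((ε : ℂ) • (I • (H * heisenbergEvolution H (ε * t) A - heisenbergEvolution H (ε * t) A * H))) t := by
  have hlin : HasDerivAt (fun u : ℝ => ε * u) (ε * 1) t := (hasDerivAt_id t).const_mul ε
  have h := (hasDerivAt_heisenbergEvolution_comm H A (ε * t)).scomp t hlin
  rw [mul_one] at h
  have hfun : ((fun u : ℝ => heisenbergEvolution H u A) ∘ fun u : ℝ => ε * u) = fun u : ℝ => heisenbergEvolution H (ε * u) A := rfl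
  rw [hfun, ← Complex.coe_smul] at h
  exact h

/-- **The resolvent integrand** `Φ(u) = e^{−au}·τ_{εu}(A)` and its derivative. -/
theorem hasDerivAt_resolventIntegrand (H A : Matrix n n ℂ) (a ε t : ℝ) :
    HasDerivAt (fun u : ℝ => ((Real.exp (-(a * u)) : ℝ) : ℂ) • heisenbergEvolution H (ε * u) A)
      (((Real.exp (-(a * t)) : ℝ) : ℂ) • ((ε : ℂ) • (I • (H * heisenbergEvolution H (ε * t) A - heisenbergEvolution H (ε * t) A * H))) +
        ((-(a * Real.exp (-(a * t))) : ℝ) : ℂ) • heisenbergEvolution H (ε * t) A) t := by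
  have he : HasDerivAt (fun u : ℝ => ((Real.exp (-(a * u)) : ℝ) : ℂ)) (((-(a * Real.exp (-(a * t))) : ℝ) : ℂ)) t := by
    have h1 : HasDerivAt (fun u : ℝ => Real.exp (-(a * u))) (Real.exp (-(a * t)) * (-(a * 1))) t :=
      ((hasDerivAt_id t).const_mul a).neg.exp
    have h2 := h1.ofReal_comp
    refine h2.congr_deriv ?_
    push_cast; ring
  exact he.smul (hasDerivAt_heisenbergEvolution_scaled H A ε t)

/-- Continuity of the Heisenberg evolution in time (local copy in this import chain). -/
theorem continuous_heisenbergEvolution' (H A : Matrix n n ℂ) : Continuous fun t : ℝ => heisenbergEvolution H t A :=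
  continuous_iff_continuousAt.mpr fun t => (hasDerivAt_heisenbergEvolution_comm H A t).continuousAt

/-! ## §3 The transfer theorem: anticommutator light cones bound every fermionic Matsubara coefficient -/

/-- **Norm of the finite-horizon resolvent anticommutator.**  For `T ≥ 0`, a time direction `ε` and a majorant
`‖{τ_{εt}(A), B}‖ ≤ F(t)` on `t ≥ 0` with `e^{−at}F(t)` integrable on `(0,∞)`:
`‖(∫₀^T e^{−at}τ_{εt}(A)dt)·B + B·(∫₀^T e^{−at}τ_{εt}(A)dt)‖ ≤ ∫_{(0,∞)} e^{−at}F(t)dt`. -/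
theorem norm_resolventHorizon_anticomm_le {H A B : Matrix n n ℂ} {a : ℝ} (ε T : ℝ) (hT : 0 ≤ T) {F : ℝ → ℝ}
    (hF : ∀ t, 0 ≤ t → ‖heisenbergEvolution H (ε * t) A * B + B * heisenbergEvolution H (ε * t) A‖ ≤ F t)
    (hFint : IntegrableOn (fun t => Real.exp (-(a * t)) * F t) (Set.Ioi 0)) :
    ‖(∫ t in (0 : ℝ)..T, ((Real.exp (-(a * t)) : ℝ) : ℂ) • heisenbergEvolution H (ε * t) A) * B +
        B * ∫ t in (0 : ℝ)..T, ((Real.exp (-(a * t)) : ℝ) : ℂ) • heisenbergEvolution H (ε * t) A‖ ≤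
      ∫ t in Set.Ioi 0, Real.exp (-(a * t)) * F t := by
  have hcont : Continuous fun t : ℝ => ((Real.exp (-(a * t)) : ℝ) : ℂ) • heisenbergEvolution H (ε * t) A :=
    (Complex.continuous_ofReal.comp (Real.continuous_exp.comp ((continuous_const.mul continuous_id).neg))).smul
      ((continuous_heisenbergEvolution' H A).comp (continuous_const.mul continuous_id))
  -- the anticommutator with `B` inside the integral
  have heq : (∫ t in (0 : ℝ)..T, ((Real.exp (-(a * t)) : ℝ) : ℂ) • heisenbergEvolution H (ε * t) A) * B +
        B * ∫ t in (0 : ℝ)..T, ((Real.exp (-(a * t)) : ℝ) : ℂ) • heisenbergEvolution H (ε * t) A =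
      ∫ t in (0 : ℝ)..T, ((Real.exp (-(a * t)) : ℝ) : ℂ) •
        (heisenbergEvolution H (ε * t) A * B + B * heisenbergEvolution H (ε * t) A) := by
    have hi1 : IntervalIntegrable (fun t => (((Real.exp (-(a * t)) : ℝ) : ℂ) • heisenbergEvolution H (ε * t) A) * B)
        MeasureTheory.volume 0 T := (hcont.mul continuous_const).intervalIntegrable _ _
    have hi2 : IntervalIntegrable (fun t => B * (((Real.exp (-(a * t)) : ℝ) : ℂ) • heisenbergEvolution H (ε * t) A))
        MeasureTheory.volume 0 T := (continuous_const.mul hcont).intervalIntegrable _ _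
    rw [intervalIntegral_mul_eq B hcont, mul_intervalIntegral_eq B hcont, ← intervalIntegral.integral_add hi1 hi2]
    refine intervalIntegral.integral_congr fun t _ => ?_
    simp only [Matrix.smul_mul, Matrix.mul_smul, smul_add]
  rw [heq]
  -- pointwise bound on `(0, T]`
  have hpt : ∀ t ∈ Set.Ioc (0 : ℝ) T, ‖((Real.exp (-(a * t)) : ℝ) : ℂ) •
      (heisenbergEvolution H (ε * t) A * B + B * heisenbergEvolution H (ε * t) A)‖ ≤ Real.exp (-(a * t)) * F t := by
    intro t ht
    rw [norm_smul, Complex.norm_real, Real.norm_of_nonneg (Real.exp_pos _).le]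
    exact mul_le_mul_of_nonneg_left (hF t ht.1.le) (Real.exp_pos _).le
  have hbound : ‖∫ t in (0 : ℝ)..T, ((Real.exp (-(a * t)) : ℝ) : ℂ) •
        (heisenbergEvolution H (ε * t) A * B + B * heisenbergEvolution H (ε * t) A)‖ ≤
      ∫ t in (0 : ℝ)..T, Real.exp (-(a * t)) * F t :=
    intervalIntegral.norm_integral_le_of_norm_le hT (Filter.Eventually.of_forall fun t ht => hpt t ht)
      ((intervalIntegrable_iff_integrableOn_Ioc_of_le hT).mpr (hFint.mono_set Set.Ioc_subset_Ioi_self))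
  refine hbound.trans ?_
  rw [intervalIntegral.integral_of_le hT]
  refine setIntegral_mono_set hFint ?_ Set.Ioc_subset_Ioi_self.eventuallyLE
  exact (ae_restrict_iff' measurableSet_Ioi).mpr (Filter.Eventually.of_forall fun t ht =>
    mul_nonneg (Real.exp_pos _).le ((norm_nonneg _).trans (hF t (le_of_lt ht))))

/-- **THE TRANSFER THEOREM.**  Let `H` be Hermitian, `β > 0`, `k` a fermionic frequency (`e^{ikβ} = −1`), and suppose the anticommutator light
cone `‖{τ_t(A), B}‖ ≤ F(t)`, `‖{τ_{−t}(A), B}‖ ≤ F(t)` for `t ≥ 0`, with `t ↦ e^{−|k|t}F(t)` integrable on `(0,∞)`.  Then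
**`‖∫₀^β e^{ikτ}⟨A(τ)B⟩_β dτ‖ ≤ ∫_{(0,∞)} e^{−|k|t}F(t) dt`.**
Proof: §1 with the finite-horizon resolvent `X_T = ∓i∫₀^T e^{−|k|t}τ_{±t}(A)dt` (§2) gives
`∫₀^β e^{ikτ}⟨A(τ)B⟩ = −⟨X_T B + B X_T⟩ + ∫₀^β e^{ikτ}⟨Φ(T)(τ)B⟩`, `Φ(T) = e^{−|k|T}τ_{±T}(A)`; the first term is bounded by
`‖{X_T,B}‖ ≤ ∫₀^∞e^{−|k|t}F` (`|⟨Y⟩_β| ≤ ‖Y‖`), the second by `β·e^{−|k|T}‖A‖‖B‖` (two-time Gibbs bound), and `T → ∞`. -/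
theorem norm_fermionic_matsubara_le_of_anticommutator_bound {H : Matrix n n ℂ} (hH : H.IsHermitian) [Nonempty n]
    {β : ℝ} (hβ : 0 < β) (A B : Matrix n n ℂ) {k : ℝ} (hk : cexp (I * k * β) = -1) {F : ℝ → ℝ}
    (hF : ∀ t, 0 ≤ t → ‖heisenbergEvolution H t A * B + B * heisenbergEvolution H t A‖ ≤ F t)
    (hF' : ∀ t, 0 ≤ t → ‖heisenbergEvolution H (-t) A * B + B * heisenbergEvolution H (-t) A‖ ≤ F t)
    (hFint : IntegrableOn (fun t => Real.exp (-(|k| * t)) * F t) (Set.Ioi 0)) :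
    ‖∫ τ in (0 : ℝ)..β, cexp (I * k * τ) * gibbsState β H (imagTimeEvolve H (τ : ℂ) A * B)‖ ≤
      ∫ t in Set.Ioi 0, Real.exp (-(|k| * t)) * F t := by
  have hk0 : k ≠ 0 := ne_zero_of_cexp_eq_neg_one hk
  set a : ℝ := |k| with ha
  have ha0 : 0 < a := abs_pos.mpr hk0
  -- sign `ε` of `k` and the constant `c = −iε`
  set ε : ℝ := if 0 < k then 1 else -1 with hε
  have hkε : k = ε * a := by
    rw [hε, ha]; split_ifs with h
    · rw [one_mul, abs_of_pos h]
    · rw [abs_of_neg (lt_of_le_of_ne (not_lt.mp h) hk0)]; ring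
  have hε2 : (ε : ℂ) * ε = 1 := by
    rw [hε]; split_ifs <;> push_cast <;> norm_num
  have hεF : ∀ t, 0 ≤ t → ‖heisenbergEvolution H (ε * t) A * B + B * heisenbergEvolution H (ε * t) A‖ ≤ F t := by
    intro t ht
    rw [hε]; split_ifs
    · rw [one_mul]; exact hF t ht
    · rw [neg_one_mul]; exact hF' t ht
  set c : ℂ := -(I * ε) with hc
  have hc1 : ‖c‖ = 1 := by
    rw [hc, norm_neg, norm_mul, Complex.norm_I, one_mul, Complex.norm_real, hε]
    split_ifs <;> simp
  -- the integrand and its derivative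
  set Φ : ℝ → Matrix n n ℂ := fun u => ((Real.exp (-(a * u)) : ℝ) : ℂ) • heisenbergEvolution H (ε * u) A with hΦ
  set Φ' : ℝ → Matrix n n ℂ := fun t =>
    ((Real.exp (-(a * t)) : ℝ) : ℂ) • ((ε : ℂ) • (I • (H * heisenbergEvolution H (ε * t) A - heisenbergEvolution H (ε * t) A * H))) +
      ((-(a * Real.exp (-(a * t))) : ℝ) : ℂ) • heisenbergEvolution H (ε * t) A with hΦ'
  have hderiv : ∀ t, HasDerivAt Φ (Φ' t) t := fun t => hasDerivAt_resolventIntegrand H A a ε t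
  have hcontev : Continuous fun t : ℝ => heisenbergEvolution H (ε * t) A :=
    (continuous_heisenbergEvolution' H A).comp (continuous_const.mul continuous_id)
  have hexpc : Continuous fun t : ℝ => ((Real.exp (-(a * t)) : ℝ) : ℂ) :=
    Complex.continuous_ofReal.comp (Real.continuous_exp.comp ((continuous_const.mul continuous_id).neg))
  have hC : Continuous fun t : ℝ => H * heisenbergEvolution H (ε * t) A - heisenbergEvolution H (ε * t) A * H :=
    (continuous_const.mul hcontev).sub (hcontev.mul continuous_const)
  have hC2 : Continuous fun t : ℝ =>
      (ε : ℂ) • (I • (H * heisenbergEvolution H (ε * t) A - heisenbergEvolution H (ε * t) A * H)) :=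
    (hC.const_smul I).const_smul (ε : ℂ)
  have hexpc' : Continuous fun t : ℝ => ((-(a * Real.exp (-(a * t))) : ℝ) : ℂ) :=
    Complex.continuous_ofReal.comp ((continuous_const.mul (Real.continuous_exp.comp
        ((continuous_const.mul continuous_id).neg))).neg)
  have hcont' : Continuous Φ' := (hexpc.smul hC2).add (hexpc'.smul hcontev)
  -- the ODE `ikc·Φ + c·[H,Φ] = −Φ′`
  have hode : ∀ t, (I * k * c) • Φ t + c • (H * Φ t - Φ t * H) = -Φ' t := by
    intro t
    have hτC : H * Φ t - Φ t * H = ((Real.exp (-(a * t)) : ℝ) : ℂ) •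
        (H * heisenbergEvolution H (ε * t) A - heisenbergEvolution H (ε * t) A * H) := by
      simp only [hΦ, Matrix.mul_smul, Matrix.smul_mul, smul_sub]
    rw [hτC]
    simp only [hΦ, hΦ', smul_smul, neg_add, ← neg_smul]
    have hcoef1 : I * (k : ℂ) * c * ((Real.exp (-(a * t)) : ℝ) : ℂ) = -(((-(a * Real.exp (-(a * t))) : ℝ) : ℂ)) := by
      rw [hkε, hc]
      simp only [Complex.ofReal_mul, Complex.ofReal_neg]
      linear_combination (-(a : ℂ) * ((Real.exp (-(a * t)) : ℝ) : ℂ) * (ε : ℂ) ^ 2) * Complex.I_mul_I +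
        ((a : ℂ) * ((Real.exp (-(a * t)) : ℝ) : ℂ)) * hε2
    have hcoef2 : c * ((Real.exp (-(a * t)) : ℝ) : ℂ) = -(((Real.exp (-(a * t)) : ℝ) : ℂ) * ((ε : ℂ) * I)) := by
      rw [hc]; ring
    rw [hcoef1, hcoef2, add_comm]
  -- §1 + §2 at horizon `T`
  have hmain : ∀ T : ℝ, 0 ≤ T →
      ‖∫ τ in (0 : ℝ)..β, cexp (I * k * τ) * gibbsState β H (imagTimeEvolve H (τ : ℂ) A * B)‖ ≤
        (∫ t in Set.Ioi 0, Real.exp (-(a * t)) * F t) + β * (Real.exp (-(a * T)) * ‖A‖ * ‖B‖) := by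
    intro T hT
    set X : Matrix n n ℂ := c • ∫ t in (0 : ℝ)..T, Φ t with hX
    have hres := resolvent_identity_of_hasDerivAt H k c T hderiv hcont' hode
    have hΦ0 : Φ 0 = A := by simp [hΦ]
    -- `A = (ikX + [H,X]) + Φ T`
    have hAeq : A = (1 : ℂ) • ((I * k : ℂ) • X + (H * X - X * H)) + (1 : ℂ) • Φ T := by
      rw [one_smul, one_smul, hX, hres, hΦ0, sub_add_cancel]
    have hsplit := matsubara_lin_left β H ((I * k : ℂ) • X + (H * X - X * H)) (Φ T) B 1 1 k
    rw [← hAeq, one_mul, one_mul, fermionic_matsubara_resolvent β H X B hk] at hsplit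
    rw [hsplit]
    refine (norm_add_le _ _).trans (add_le_add ?_ ?_)
    · -- `‖⟨XB + BX⟩‖ ≤ ‖XB + BX‖ ≤ ∫ e^{-at} F`
      rw [norm_neg]
      refine (norm_gibbsState_le hH β _).trans ?_
      have hXB : X * B + B * X = c • ((∫ t in (0 : ℝ)..T, Φ t) * B + B * ∫ t in (0 : ℝ)..T, Φ t) := by
        rw [hX, Matrix.smul_mul, Matrix.mul_smul, smul_add]
      rw [hXB, norm_smul, hc1, one_mul]
      exact norm_resolventHorizon_anticomm_le ε T hT hεF hFint
    · -- the horizon remainder: `β e^{-aT} ‖A‖ ‖B‖`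
      have hpt : ∀ τ ∈ Set.Ioc (0 : ℝ) β, ‖cexp (I * k * τ) * gibbsState β H (imagTimeEvolve H (τ : ℂ) (Φ T) * B)‖ ≤
          Real.exp (-(a * T)) * ‖A‖ * ‖B‖ := by
        intro τ hτ
        rw [norm_mul, show I * (k : ℂ) * (τ : ℂ) = ((k * τ : ℝ) : ℂ) * I by push_cast; ring, Complex.norm_exp_ofReal_mul_I, one_mul]
        refine (norm_gibbsState_imagTimeEvolve_mul_le hH hτ.1.le hτ.2 _ _).trans ?_
        simp only [hΦ]
        rw [norm_smul, Complex.norm_real, Real.norm_of_nonneg (Real.exp_pos _).le, norm_heisenbergEvolution_holds hH]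
      have h := intervalIntegral.norm_integral_le_of_norm_le_const (a := (0 : ℝ)) (b := β)
        (f := fun τ => cexp (I * k * τ) * gibbsState β H (imagTimeEvolve H (τ : ℂ) (Φ T) * B))
        (C := Real.exp (-(a * T)) * ‖A‖ * ‖B‖) (fun τ hτ => hpt τ (by rwa [Set.uIoc_of_le hβ.le] at hτ))
      rw [sub_zero, abs_of_pos hβ] at h
      linarith
  -- `T → ∞`
  refine le_of_forall_pos_lt_add fun δ hδ => ?_
  obtain ⟨T, hT0, hT⟩ : ∃ T : ℝ, 0 ≤ T ∧ β * (Real.exp (-(a * T)) * ‖A‖ * ‖B‖) < δ := by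
    have hlim : Filter.Tendsto (fun T : ℝ => β * (Real.exp (-(a * T)) * ‖A‖ * ‖B‖)) Filter.atTop
        (nhds (β * (0 * ‖A‖ * ‖B‖))) := by
      refine Filter.Tendsto.const_mul β (Filter.Tendsto.mul_const _ (Filter.Tendsto.mul_const _ ?_))
      exact Real.tendsto_exp_neg_atTop_nhds_zero.comp (Filter.tendsto_id.const_mul_atTop ha0)
    rw [zero_mul, zero_mul, mul_zero] at hlim
    obtain ⟨T, hT⟩ := ((hlim.eventually (gt_mem_nhds hδ)).and (Filter.eventually_ge_atTop 0)).exists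
    exact ⟨T, hT.2, hT.1⟩
  calc ‖∫ τ in (0 : ℝ)..β, cexp (I * k * τ) * gibbsState β H (imagTimeEvolve H (τ : ℂ) A * B)‖
      ≤ (∫ t in Set.Ioi 0, Real.exp (-(a * t)) * F t) + β * (Real.exp (-(a * T)) * ‖A‖ * ‖B‖) := hmain T hT0
    _ < (∫ t in Set.Ioi 0, Real.exp (-(a * t)) * F t) + δ := by linarith

end Summit.HubbardSuperconductivity.HubbardSuperconductivity.Theorems.ThermalGreen

end
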